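import Literature.MathematicalPhysics.QuantumFieldTheory.Balaban1983to89.B9Eq383QSemiLocal
import Literature.MathematicalPhysics.QuantumFieldTheory.Balaban1983to89.B9Eq315QTowerLipschitz
import Literature.MathematicalPhysics.QuantumFieldTheory.Balaban1983to89.B9Eq349BlockDistanceWeight

/-!
# `Balaban1983to89.B9Eq315QLocalLetter` — T. Bałaban, *Propagators for lattice gauge theories in a background field*, Commun. Math. Phys. **99** (1985)
# 389–434 [Balaban1985BackgroundPropagators] (3.15) p. 393 (the vector-field averaging `Q(U)`), (3.83) p. 407, Thm 3.1 (3.42) p. 397, (3.153) p. 426, with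
# [Balaban1985Averaging] p. 24 *«depends only on the bond variables … b ⊂ B(c₋) ∪ B(c₊)»*, (126) p. 36: **THE (3.42)-LETTER OF THE ONE-STEP VECTOR
# AVERAGING `Q(U)` — (L)(Q(U); (1 + 50(d+1)α)·e^{κ}, κ) FOR EVERY `κ ≥ 0`** on the `𝔸`-valued bond functions of the torus, and
# (L)(Q(U); M_φ′M_φ(1 + 50(d+1)α)·e^{κ}, κ) for the chain's `B9Eq315QTorus.QtorusW` on the weighted `L²` carriers: `Q(U)` is SEMI-LOCAL
# (`B9Eq383QSemiLocal.QtorusLin_congr_local`: range ONE block) and sup-bounded (`B9Eq315QTowerLipschitz.norm_QtorusLin_apply_le`: [B7] (126)), so the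
# one-bond-range bookkeeping of this lineage's `B9Eq33CovDerivLocalLetter` applies verbatim — the `hQl` inhabitant of this lineage's
# `B9Eq3153FrakGLocalLetter.local_letter_frakGofU_of_letters` at `Q := QtorusW` (`B9Eq315QTorus.laplaceAofBackground`), pub-balaban NE9 owner's plan v10
# §6 OPEN (4)

statement-level skeleton of published theorems with citation tags; proofs where landed; nothing here is a claim about the Yang–Mills mass gap

CITATION HEADER (lean-in-tree rule).  Audit cell `pub-balaban`, sub-cell `t4`, BINDER row NE9; filed by NE9 crux-team LEAF PROVER 03
(`b2b-balaban-t4-ne9-formalise-leaf-03`, gen 72).  Sources READ in the held renders: [Balaban1985BackgroundPropagators] p. 393 (3.15)–(3.16), p. 397 (3.42),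
p. 407 (3.83); [Balaban1985Averaging] p. 24, p. 36 (121)–(126).  NOTHING printed is asserted: the block-loop regularity `α ≤ 1∕64` of the extended
background and the fibre-norm letters `M_φ`, `M_φ′` are DISPLAYED; [folklore] one-block-range bookkeeping.

WHAT IS PROVED (sorry-free; proof lane — no `def`; context = `B9Eq383QSemiLocal`'s: torus `T_{(Lm)}`, `1 ≤ L`, background `U` with `hU1`, `hreg`).
* **`QtorusLin_apply_eq_zero_of_support`** — `A` supported on the fine bonds based in `B(v)`; `c₋ ≠ v` and `c₋ + e_{c.2} ≠ v` ⟹ `(Q(U)A)(c) = 0`.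
* **`local_QtorusLin`** — for `A` supported in `B(v)` (base points) with `‖A‖ ≤ a`, every `κ ≥ 0` and every coarse bond `c`:
  `‖(Q(U)A)(c)‖ ≤ (1 + 50(d+1)α)·e^{κ}·e^{−κ·d_m(c₋, v)}·a` (block of a coarse bond = its base point; `1 ≤ m_i`).
* **`local_QtorusW`** — the same for `WL2.equiv (QtorusW L m hL φ U hα1 hU1 hreg f) c` with the fibre read along `φ` (`‖φw‖ ≤ M_φ‖w‖`,
  `‖φ⁻¹X‖ ≤ M_φ′‖X‖`): constant `M_φ′·M_φ·(1 + 50(d+1)α)·e^{κ}` — VERBATIM the `hQl` binder of `B9Eq3153FrakGLocalLetter.local_letter_frakGofU_of_letters`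
  with `F := BondL2K ℂ d m c₁ W`, `eF := WL2.linearEquiv`, `πF := bpos`.
HONEST SCOPE.  One factor's letter; no decay is produced (`e^{κ}` pays for the one-block range); nothing of (3.42) ∕ Thm 3.1 asserted; the adjoint `Q(U)†` and
the composite `Q_k(U)` letters are NOT here; NOT NE9 (cell pub-balaban: NE9 NOT PRINTED ∕ NOT PROVED; «NE9 ⇐ the named binders»; row WALLED ON A MODEL
(O-NE9-1; #5 UNRULED); spine PROVED 0∕9; rung (B)+1 on a finite T⁴ — NOT infinite volume, NOT mass gap, NOT Clay; HONEST DEPENDENCY: continuum YM on T⁴ ⇐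
BetaPertH ∧ nine spine estimates (0/9 proved); BetaPertH ⇐ (D1) ∧ (D4) ∧ CAP+tail; G-an2-4 gates asym, D1 and NE2/3/4).  NEW file importing
`B9Eq383QSemiLocal`, `B9Eq315QTowerLipschitz`, `B9Eq349BlockDistanceWeight` (all built); nothing modified.  Net new unproved facts: 0.
-/

noncomputable section

open scoped BigOperators

namespace Literature.MathematicalPhysics.QuantumFieldTheory.Balaban1983to89.B9Eq315QLocalLetter

open B4Sect5Torus (TSite tdist tdist_self)
open B9SectCLatticeCarrier (Bond bpos shift)
open B7Prop1Explicit (U1 Wcx boxVec)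
open B9Eq311L2Pairing (WL2)
open B11Eq103H1Complex (BondL2K)
open B9Eq319QprimeTorus (fineP blockCoord)
open B9Eq315QTorus (perCfg cornerSite QtorusLin QtorusW QtorusW_apply)
open B9Eq383QSemiLocal (QtorusLin_congr_local)
open B9Eq315QTowerLipschitz (norm_QtorusLin_apply_le)
open B9Eq349BlockDistanceWeight (tdist_shift_le_one)

variable {d : ℕ} (L : ℕ) [NeZero L] (m : Fin d → ℕ) [∀ i, NeZero (m i)] [∀ i, NeZero (fineP L m i)]
  {𝔸 : Type*} [NormedRing 𝔸] [NormedAlgebra ℂ 𝔸] [CompleteSpace 𝔸] [NormOneClass 𝔸] (hL : 1 ≤ L)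
  (U : Bond d (fineP L m) → 𝔸ˣ) {α : ℝ} (hα1 : α ≤ 1 / 64)
  (hU1 : ∀ (x : B7Prop1Explicit.Site d) (κ : Fin d), perCfg (fineP L m) U x κ ∈ U1 𝔸)
  (hreg : ∀ (y : TSite d m) (κ : Fin d) (r : Fin d → Fin L),
    ‖((Wcx L (perCfg (fineP L m) U) (cornerSite L y) κ (boxVec L r) : 𝔸ˣ) : 𝔸) - 1‖ ≤ α)

/-! ## §1 The plain letter of `Q(U)` on the torus -/

omit [NeZero L] [∀ i, NeZero (m i)] in
/-- **`Q(U)` HAS RANGE ONE BLOCK**: if `A` vanishes on every fine bond based outside `B(v)`, then `(Q(U)A)(c) = 0` unless `v ∈ {c₋, c₋ + e_{c.2}}` —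
`B9Eq383QSemiLocal.QtorusLin_congr_local` against `A′ = 0`. [folklore] [cite: Balaban1985Averaging, p.24; Balaban1985BackgroundPropagators, (3.15) p.393, (3.83) p.407] -/
theorem QtorusLin_apply_eq_zero_of_support (v : TSite d m) (A : Bond d (fineP L m) → 𝔸) (hAv : ∀ b, blockCoord L m b.1 ≠ v → A b = 0)
    (c : Bond d m) (h1 : c.1 ≠ v) (h2 : shift c.2 c.1 ≠ v) : QtorusLin L m hL U hα1 hU1 hreg A c = 0 := by
  have h : QtorusLin L m hL U hα1 hU1 hreg A c = QtorusLin L m hL U hα1 hU1 hreg 0 c :=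
    QtorusLin_congr_local L m hL U hα1 hU1 hreg c fun b hb => by
      rcases hb with hb | hb
      · exact hAv b (by rw [hb]; exact h1)
      · exact hAv b (by rw [hb]; exact h2)
  rw [h, map_zero, Pi.zero_apply]

/-- **THE VECTOR AVERAGING `Q(U)` CARRIES THE LETTER (L) AT EVERY RATE `κ ≥ 0`** (block of a coarse bond = its base point; `1 ≤ m_i`): for `A` supported on
the fine bonds based in `B(v)` with `‖A(b)‖ ≤ a`, `‖(Q(U)A)(c)‖ ≤ (1 + 50(d+1)α)·e^{κ}·e^{−κ·d_m(c₋,v)}·a` — `Q(U)A` vanishes at `c` unless `v` is `c₋` or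
its neighbour `c₋ + e_{c.2}` (`d_m ≤ 1`), and `‖(Q(U)A)(c)‖ ≤ (1 + 50(d+1)α)·a` ([B7] (126), `B9Eq315QTowerLipschitz.norm_QtorusLin_apply_le`). [folklore]
[cite: Balaban1985BackgroundPropagators, (3.15) p.393, Thm 3.1 (3.42) p.397, (3.153) p.426; Balaban1985Averaging, (126) p.36] -/
theorem local_QtorusLin (hm : ∀ i, 1 ≤ m i) {κ : ℝ} (hκ : 0 ≤ κ) (v : TSite d m) (A : Bond d (fineP L m) → 𝔸) (a : ℝ)
    (hAv : ∀ b, blockCoord L m b.1 ≠ v → A b = 0) (hAa : ∀ b, ‖A b‖ ≤ a) (c : Bond d m) :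
    ‖QtorusLin L m hL U hα1 hU1 hreg A c‖ ≤ (1 + 50 * (d + 1) * α) * Real.exp κ * Real.exp (-(κ * tdist m c.1 v)) * a := by
  have ha : 0 ≤ a := (norm_nonneg _).trans (hAa ((fun i => ⟨0, Nat.pos_of_ne_zero (NeZero.ne _)⟩), c.2))
  have hα0 : 0 ≤ α := (norm_nonneg _).trans (hreg c.1 c.2 fun _ => 0)
  have hC : 0 ≤ (1 + 50 * (d + 1) * α) := by positivity
  have hsup := norm_QtorusLin_apply_le L m hL U hα1 hU1 hreg A ha hAa c
  have hcomp : ∀ {D : ℝ}, D ≤ 1 →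
      (1 + 50 * (d + 1) * α) * a ≤ (1 + 50 * (d + 1) * α) * Real.exp κ * Real.exp (-(κ * D)) * a := fun {D} hD => by
    have h1 : (1 : ℝ) ≤ Real.exp κ * Real.exp (-(κ * D)) := by
      rw [← Real.exp_add]
      exact Real.one_le_exp (by nlinarith [mul_le_mul_of_nonneg_left hD hκ])
    calc (1 + 50 * (d + 1) * α) * a = (1 + 50 * (d + 1) * α) * a * 1 := (mul_one _).symm
      _ ≤ (1 + 50 * (d + 1) * α) * a * (Real.exp κ * Real.exp (-(κ * D))) := mul_le_mul_of_nonneg_left h1 (mul_nonneg hC ha)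
      _ = (1 + 50 * (d + 1) * α) * Real.exp κ * Real.exp (-(κ * D)) * a := by ring
  by_cases h1 : c.1 = v
  · rw [h1, tdist_self]
    exact hsup.trans (hcomp zero_le_one)
  · by_cases h2 : shift c.2 c.1 = v
    · have hD : tdist m c.1 v ≤ 1 := by rw [← h2]; exact tdist_shift_le_one hm c.1 c.2
      exact hsup.trans (hcomp hD)
    · rw [QtorusLin_apply_eq_zero_of_support L m hL U hα1 hU1 hreg v A hAv c h1 h2, norm_zero]
      exact mul_nonneg (mul_nonneg (mul_nonneg hC (Real.exp_nonneg _)) (Real.exp_nonneg _)) ha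

/-! ## §2 The chain's `Q(U)` on the weighted `L²` carriers -/

variable {W : Type*} [NormedAddCommGroup W] [InnerProductSpace ℂ W] (φ : W ≃ₗ[ℂ] 𝔸) {c₀ c₁ : ℝ} {Mφ Mφ' : ℝ}
  (hφ : ∀ w, ‖φ w‖ ≤ Mφ * ‖w‖) (hφ' : ∀ X, ‖φ.symm X‖ ≤ Mφ' * ‖X‖) (hMφ : 0 ≤ Mφ) (hMφ' : 0 ≤ Mφ')

include hφ hφ' hMφ hMφ' in
/-- **THE LETTER (L) OF THE CHAIN's `Q(U) = B9Eq315QTorus.QtorusW`** (fibre read along `φ`, fine bonds weighted by `c₀`, coarse bonds by `c₁`; the weights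
do not enter a sup letter): for `f` supported on the fine bonds based in `B(v)` with `‖f(b)‖ ≤ F`, every `κ ≥ 0` and every coarse bond `c`,
`‖(Q(U)f)(c)‖ ≤ M_φ′·M_φ·(1 + 50(d+1)α)·e^{κ}·e^{−κ·d_m(c₋,v)}·F` — VERBATIM the `hQl` binder of `B9Eq3153FrakGLocalLetter.local_letter_frakGofU_of_letters`
at `Q := QtorusW`, `eF := WL2.linearEquiv`, `πF := bpos`. [folklore] [cite: Balaban1985BackgroundPropagators, (3.15) p.393, Thm 3.1 (3.42) p.397, (3.153) p.426; Balaban1985Averaging, (126) p.36] -/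
theorem local_QtorusW (hm : ∀ i, 1 ≤ m i) {κ : ℝ} (hκ : 0 ≤ κ) (v : TSite d m) (f : BondL2K ℂ d (fineP L m) c₀ W) (F : ℝ)
    (hfv : ∀ b, blockCoord L m (bpos b) ≠ v → WL2.equiv ℂ (fun _ : Bond d (fineP L m) => c₀) W f b = 0)
    (hfF : ∀ b, ‖WL2.equiv ℂ (fun _ : Bond d (fineP L m) => c₀) W f b‖ ≤ F) (c : Bond d m) :
    ‖WL2.equiv ℂ (fun _ : Bond d m => c₁) W (QtorusW L m hL φ U hα1 hU1 hreg (c₁ := c₁) f) c‖ ≤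
      Mφ' * Mφ * (1 + 50 * (d + 1) * α) * Real.exp κ * Real.exp (-(κ * tdist m (bpos c) v)) * F := by
  rw [QtorusW_apply]
  have h := local_QtorusLin L m hL U hα1 hU1 hreg hm hκ v (fun b => φ (WL2.equiv ℂ (fun _ : Bond d (fineP L m) => c₀) W f b)) (Mφ * F)
    (fun b hb => by simp only [hfv b hb, map_zero]) (fun b => (hφ _).trans (mul_le_mul_of_nonneg_left (hfF b) hMφ)) c
  calc _ ≤ Mφ' * ‖QtorusLin L m hL U hα1 hU1 hreg (fun b => φ (WL2.equiv ℂ (fun _ : Bond d (fineP L m) => c₀) W f b)) c‖ := hφ' _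
    _ ≤ Mφ' * ((1 + 50 * (d + 1) * α) * Real.exp κ * Real.exp (-(κ * tdist m c.1 v)) * (Mφ * F)) := mul_le_mul_of_nonneg_left h hMφ'
    _ = Mφ' * Mφ * (1 + 50 * (d + 1) * α) * Real.exp κ * Real.exp (-(κ * tdist m (bpos c) v)) * F := by rw [bpos]; ring

end Literature.MathematicalPhysics.QuantumFieldTheory.Balaban1983to89.B9Eq315QLocalLetter

end
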